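import Summits.Langlands.Langlands.Theses.PicardMuOrdinary

/-!
# The branch table of `MuOrdinaryFamilyRT` at inert primes: integers are squares in `𝔽_{p²}`

Negative-lane remark for the crux `PicardMuOrdinary.MuOrdinaryFamilyRT` (stmt-Langlands-13757),
standing disprover refuter-cdisprove-stmt-Langlands-13757-g2-0, cycle 2 (2026-08-16).

The residual hypothesis of the crux reads a five-branch table indexed by the number of roots of
`f mod 𝔭` in `𝓞_K/𝔭` and, when there are none, by whether `disc(f mod 𝔭)` is a square there.
At a prime `𝔭` of `K = ℚ(ω)` inert over `p ≡ 2 (mod 3)` the residue field is `𝔽_{p²}`, and the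
theorem below shows that every integer is a square in a finite field of order `p^(2m)`; hence the
discriminant branch always reads "square" at inert primes, the branch `X³+X²+X+1` (4-cycle) never
fires there, and `#roots = 2` (transposition) cannot occur for unramified `p` — consistent with
`Frob_𝔭 = Frob_p² ∈ A₄`.  Audit (no inconsistency), recorded so that the coincidence is not
mistaken for a defect of the table.
-/

namespace Summit.Langlands.Langlands.Theorems.MuOrdinaryFamilyRT.Negative

set_option linter.dupNamespace false

open Polynomial


/-- `2 (p − 1) ∣ p^(2m) − 1` for an odd prime `p`. [folklore] -/
theorem two_mul_sub_one_dvd_pow_two_mul_sub_one {p : ℕ} (hp : Odd p) (m : ℕ) :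
    2 * (p - 1) ∣ p ^ (2 * m) - 1 := by
  have h1 : p ^ (2 * m) - 1 = (p ^ m + 1) * (p ^ m - 1) := by
    have : p ^ (2 * m) = (p ^ m) ^ 2 := by rw [pow_mul']
    rw [this]
    simpa using Nat.sq_sub_sq (p ^ m) 1
  rw [h1]
  refine mul_dvd_mul ?_ ?_
  · exact (hp.pow.add_odd odd_one).two_dvd
  · exact Nat.sub_one_dvd_pow_sub_one p m

/-- **Integers are squares in a finite field of square order.**  In a finite field `F` with
`#F = p^(2m)`, every element of the prime field — in particular every `(n : F)`, `n ∈ ℤ` — is a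
square (`a^{(#F−1)/2} = (a^{p−1})^{…} = 1`, Euler's criterion).  Consequence for the crux's
branch table: at a prime `𝔭` of `K = ℚ(ω)` INERT over `p ≡ 2 (mod 3)` the residue field is
`𝔽_{p²}`, the discriminant of `f̄` (an integer) is automatically a square there, so the last
branch `X³ + X² + X + 1` (4-cycle) never fires — consistent with `Frob_𝔭 = Frob_p² ∈ A₄`
(squares in `S₄` are `1`, double transpositions, 3-cycles), as is the absence of the transposition
branch (`#roots = 2` is impossible in `𝔽_{p²}` for unramified `p`).  The table is therefore only
ever read on `{(X−1)³, X³−1, (X−1)(X+1)²}` at inert primes; no inconsistency. [folklore] -/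
theorem intCast_isSquare_of_card_eq_pow_two_mul {F : Type*} [Field F] [Fintype F] {p : ℕ}
    [Fact p.Prime] [CharP F p] {m : ℕ} (hcard : Fintype.card F = p ^ (2 * m)) (n : ℤ) :
    IsSquare (n : F) := by
  classical
  by_cases h2 : ringChar F = 2
  · exact FiniteField.isSquare_of_char_two h2 _
  by_cases hn : (n : F) = 0
  · rw [hn]; exact ⟨0, by simp⟩
  have hp : p.Prime := Fact.out
  have hpchar : ringChar F = p := ringChar.eq F p
  have hp2 : p ≠ 2 := fun h => h2 (hpchar.trans h)
  have hpodd : Odd p := hp.odd_of_ne_two hp2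
  -- Fermat for the image of the prime field
  have hfermat : (n : F) ^ (p - 1) = 1 := by
    set ψ : ZMod p →+* F := ZMod.castHom (dvd_refl p) F with hψ
    have hψn : ψ (n : ZMod p) = (n : F) := map_intCast ψ n
    have hn0 : (n : ZMod p) ≠ 0 := by
      intro h0
      apply hn
      rw [← hψn, h0, map_zero]
    have := ZMod.pow_card_sub_one_eq_one hn0
    rw [← hψn, ← map_pow, this, map_one]
  rw [FiniteField.isSquare_iff h2 hn, hcard]
  -- exponent bookkeeping: p^(2m)/2 = (p-1) * c
  obtain ⟨c, hc⟩ := two_mul_sub_one_dvd_pow_two_mul_sub_one hpodd m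
  have hodd : p ^ (2 * m) % 2 = 1 := Nat.odd_iff.mp hpodd.pow
  have h2e : 2 * (p ^ (2 * m) / 2) = p ^ (2 * m) - 1 := Nat.two_mul_odd_div_two hodd
  have he : p ^ (2 * m) / 2 = (p - 1) * c := by
    apply Nat.eq_of_mul_eq_mul_left (by norm_num : 0 < 2)
    rw [h2e, hc]; ring
  rw [he, pow_mul, hfermat, one_pow]


end Summit.Langlands.Langlands.Theorems.MuOrdinaryFamilyRT.Negative
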